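import Mathlib
import HarnessLib.Audit
import Summits.PneNP.PneNP.Theorems.PstarGateCasePNorThrough
import Summits.PneNP.PneNP.Theorems.PstarNorUnitEQ1Tools

/-!
# One GATED chord, node N1 (CASE P, (NOR) chord): the JOINS are pinned by the NOR literals — `T₂` realises `{σ, τ}`, `T₁` meets `{σ, τ, u}` (E2; prover-1 g18)

FRONTIER range-avoidance ladder, rung F-N3 (`stmt-PneNP-19007`), cell `pnp-ideate` (`PstarGateNodesX.GateCasePNorX`; this seat's
`HOME/pnp-ideate-prover-1/g18/E2-PLAN-v3.md` §3); restricted-model proof complexity — nothing here bears on `P` versus `NP`.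

Continuing `PstarGateCasePNorThrough`: CASE P with a (NOR) chord `e'`, NOR literals `σ ∈ j₁`, `τ ∈ j₂` (`D e' = {j₁, j₂}` the CONS-T pair).
Together with `PstarBridgeJoins.mem_join_of_not_mem_fundamental` (every tree edge is a fundamental-cycle edge or a join edge) this prices EVERY output of
the core for the N1 count:

* `through_of_const_on_flat_affine` — `PstarGateCasePNor.through_of_const_on_flat` with an affine perturbation (second differences kill it);
* `caseP_nor_structure` — one invocation of the clean `nor_unit_of_dir` plus:  (a) every edge of `D e` has an AND variable in `{σ, τ, u}` (as in
  `caseP_nor_through`);  (b) **every edge of the second join `T₂` has AND pair `{σ, τ}`** (the polar form of `q` is `ℓ_b ⊗ ℓ_a + ℓ_a ⊗ ℓ_b`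
  (`polar_unique`), it takes the value `[j ∈ T₂]` on the AND pair of a core output (`PstarNorUnitEQ1Tools.polarDir_single_pair`), and the literal
  functionals live on `{σ, τ}`; the literal pair is exported cert-independently: `v` literal ⟺ `q` not `e_v`-invariant);  (c) **every edge of the first join `T₁` and every private-free monomial of the first constraint has an AND variable
  in `{σ, τ, u}`**: on the flat `{x_σ, x_τ, x_u fixed at a point of Z(q) ∩ {ℓ ≠ 0}}` all chords are ON (`caseP_forced`), so by `caseP_fst` the
  state-free first coordinate `free₁` is constant there, and `free₁ = Q_{T₁ ∪ freeMon G₁} +` affine.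
-/

set_option linter.dupNamespace false -- `Summit.PneNP.PneNP.…`: summit = sub-problem name (D-0017 single-conjunct layout)

open Finset Module Literature.Computability.Complexity
open Summit.PneNP.PneNP.Theorems.PstarFibrePolys (bit)
open Summit.PneNP.PneNP.Theorems.PstarTyped (Typed)
open Summit.PneNP.PneNP.Theorems.PstarSALevel (BoundaryExpanding SimpleOverlap)
open Summit.PneNP.PneNP.Theorems.PstarGapLinearised (andPair)
open Summit.PneNP.PneNP.Theorems.PstarXCore (xverts)
open Summit.PneNP.PneNP.Theorems.PstarCoreBound (XorClosed)
open Summit.PneNP.PneNP.Theorems.PstarCubeIdeals (IsAffineFn)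
open Summit.PneNP.PneNP.Theorems.PstarRankRigidityTwo (linPart symForm symForm_apply linPart_apply affine_mul_polar)
open Summit.PneNP.PneNP.Theorems.PstarForcing (polar_unique)
open Summit.PneNP.PneNP.Theorems.PstarProductRank (qform polar qform_add)
open Summit.PneNP.PneNP.Theorems.PstarPathRank (polar_basis and_ne)
open Summit.PneNP.PneNP.Theorems.PstarReadSumset (V2)
open Summit.PneNP.PneNP.Theorems.PstarChordSystem (ChordSystem)
open Summit.PneNP.PneNP.Theorems.PstarChordBridgeTools (privs coef free)
open Summit.PneNP.PneNP.Theorems.PstarChordBridge (BridgeData sys Solution Lift sys_F)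
open Summit.PneNP.PneNP.Theorems.PstarChordBridgeCotree (Peelable)
open Summit.PneNP.PneNP.Theorems.PstarChordBridgeForcing (gam freeMon sys_u_eq)
open Summit.PneNP.PneNP.Theorems.PstarChordBridgeBasis (qDir polarDir)
open Summit.PneNP.PneNP.Theorems.PstarChordBridgeCorner (qDir_add)
open Summit.PneNP.PneNP.Theorems.PstarNorUnitDir (nor_unit_of_dir)
open Summit.PneNP.PneNP.Theorems.PstarNorUnitEQ1Tools (polarDir_single_pair)
open Summit.PneNP.PneNP.Theorems.PstarGateBridge (GateHyp gate_reads const_of_others caseP_forced caseP_fst)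
open Summit.PneNP.PneNP.Theorems.PstarGateCasePRegimes (NorCert)
open Summit.PneNP.PneNP.Theorems.PstarGateCasePNor (through_of_const_on_flat)
open Summit.PneNP.PneNP.Theorems.PstarGateNodes (GateData ReadAlong AllRead)
open Summit.PneNP.PneNP.Theorems.PstarGateNodesX (GateDataX)
open Summit.PneNP.PneNP.Theorems.PstarGateCasePNorThrough (zpoint_caseP polarDir_eq_of_agree)

namespace Summit.PneNP.PneNP.Theorems.PstarGateCasePNorJoins

variable {n m : ℕ}

/-- **An AND-sum plus an affine function, constant on a coordinate flat, has every edge meeting the frozen coordinates.** -/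
theorem through_of_const_on_flat_affine (I : LocalMap 4 n m) (hI : I.IsPure xorAndPred) (hS : SimpleOverlap I) (S : Finset (Fin m))
    (Γ : Finset (Fin n)) (c : Fin n → ZMod 2) (κ : ZMod 2) {lam : (Fin n → ZMod 2) → ZMod 2} (hlam : IsAffineFn lam)
    (h : ∀ x : Fin n → ZMod 2, (∀ v ∈ Γ, x v = c v) → qform S (fun j => I.vars j 2) (fun j => I.vars j 3) x + lam x = κ) :
    ∀ j ∈ S, I.vars j 2 ∈ Γ ∨ I.vars j 3 ∈ Γ := by
  classical
  intro j hj
  by_contra hnot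
  push Not at hnot
  obtain ⟨haΓ, hbΓ⟩ := hnot
  set x₀ : Fin n → ZMod 2 := fun v => if v ∈ Γ then c v else 0 with hx₀
  set ea : Fin n → ZMod 2 := Pi.single (I.vars j 2) 1 with hea
  set eb : Fin n → ZMod 2 := Pi.single (I.vars j 3) 1 with heb
  have hx₀Γ : ∀ v ∈ Γ, x₀ v = c v := fun v hv => by rw [hx₀]; exact if_pos hv
  have heaΓ : ∀ v ∈ Γ, ea v = 0 := fun v hv => by
    rw [hea]; exact Pi.single_eq_of_ne (fun h : v = I.vars j 2 => haΓ (h ▸ hv)) _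
  have hebΓ : ∀ v ∈ Γ, eb v = 0 := fun v hv => by
    rw [heb]; exact Pi.single_eq_of_ne (fun h : v = I.vars j 3 => hbΓ (h ▸ hv)) _
  have h1 := h x₀ hx₀Γ
  have h2 := h (x₀ + ea) (fun v hv => by rw [Pi.add_apply, hx₀Γ v hv, heaΓ v hv, add_zero])
  have h3 := h (x₀ + eb) (fun v hv => by rw [Pi.add_apply, hx₀Γ v hv, hebΓ v hv, add_zero])
  have h4 := h (x₀ + ea + eb) (fun v hv => by rw [Pi.add_apply, Pi.add_apply, hx₀Γ v hv, heaΓ v hv, hebΓ v hv, add_zero, add_zero])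
  have hab : polar S (fun j => I.vars j 2) (fun j => I.vars j 3) ea eb = 1 := by
    rw [hea, heb, polar_basis I hI hS S]
    exact if_pos ⟨j, hj, Or.inl ⟨rfl, rfl⟩⟩
  -- second differences: the AND-sum gives the polar value `1`, the affine part gives `0`
  set qf : (Fin n → ZMod 2) → ZMod 2 := fun x => qform S (fun j => I.vars j 2) (fun j => I.vars j 3) x with hqf
  have hQ : qf (x₀ + ea + eb) + qf (x₀ + ea) + qf (x₀ + eb) + qf x₀ = 1 := by
    simp only [hqf]
    rw [qform_add S _ _ (x₀ + ea) eb, qform_add S _ _ x₀ eb, LinearMap.map_add₂, hab]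
    generalize qform S (fun j => I.vars j 2) (fun j => I.vars j 3) (x₀ + ea) = A
    generalize qform S (fun j => I.vars j 2) (fun j => I.vars j 3) eb = E
    generalize qform S (fun j => I.vars j 2) (fun j => I.vars j 3) (0 : Fin n → ZMod 2) = Z
    generalize qform S (fun j => I.vars j 2) (fun j => I.vars j 3) x₀ = X0
    generalize polar S (fun j => I.vars j 2) (fun j => I.vars j 3) x₀ eb = P
    revert A E Z X0 P; decide
  have hL : lam (x₀ + ea + eb) + lam (x₀ + ea) + lam (x₀ + eb) + lam x₀ = 0 := by
    rw [hlam (x₀ + ea) eb, hlam x₀ eb]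
    generalize lam (x₀ + ea) = A; generalize lam eb = E; generalize lam 0 = Z; generalize lam x₀ = X0
    revert A E Z X0; decide
  have hsum : (qf (x₀ + ea + eb) + lam (x₀ + ea + eb)) + (qf (x₀ + ea) + lam (x₀ + ea)) + (qf (x₀ + eb) + lam (x₀ + eb)) + (qf x₀ + lam x₀) =
      κ + κ + κ + κ := by
    simp only [hqf]
    rw [h1, h2, h3, h4]
  have hre : (qf (x₀ + ea + eb) + lam (x₀ + ea + eb)) + (qf (x₀ + ea) + lam (x₀ + ea)) + (qf (x₀ + eb) + lam (x₀ + eb)) + (qf x₀ + lam x₀) =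
      (qf (x₀ + ea + eb) + qf (x₀ + ea) + qf (x₀ + eb) + qf x₀) + (lam (x₀ + ea + eb) + lam (x₀ + ea) + lam (x₀ + eb) + lam x₀) := by ring
  rw [hre, hQ, hL] at hsum
  have e4 : ∀ k : ZMod 2, (1 : ZMod 2) + 0 ≠ k + k + k + k := by decide
  exact e4 κ hsum

/-- The state-free part of a constraint: the AND-sum of its join and private-free monomials plus an affine function. -/
theorem free_eq_qform (I : LocalMap 4 n m) (y : Fin m → Bool) (F N T : Finset (Fin m)) (C : Finset (Fin n)) (G : Finset (Fin m))
    (hTG : Disjoint T (freeMon I N G)) (x : Fin n → ZMod 2) :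
    free I y F N T C G x = qform (T ∪ freeMon I N G) (fun j => I.vars j 2) (fun j => I.vars j 3) x +
      ((∑ v ∈ C.filter (fun v => v ∉ xverts I F ∧ v ∉ privs I N), x v) + ∑ j ∈ T, bit (y j)) := by
  classical
  unfold PstarChordBridgeTools.free PstarProductRank.qform PstarChordBridgeForcing.freeMon
  unfold PstarChordBridgeForcing.freeMon at hTG
  rw [sum_union hTG, sum_add_distrib]
  ring

/-- The affine part of `free` is affine. -/
theorem isAffineFn_freeLin (I : LocalMap 4 n m) (y : Fin m → Bool) (F N T : Finset (Fin m)) (C : Finset (Fin n)) :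
    IsAffineFn (fun x : Fin n → ZMod 2 => (∑ v ∈ C.filter (fun v => v ∉ xverts I F ∧ v ∉ privs I N), x v) + ∑ j ∈ T, bit (y j)) := by
  intro x w
  simp only [Pi.add_apply, sum_add_distrib, Pi.zero_apply, sum_const_zero, zero_add]
  generalize ∑ v ∈ C.filter (fun v => v ∉ xverts I F ∧ v ∉ privs I N), x v = A
  generalize ∑ v ∈ C.filter (fun v => v ∉ xverts I F ∧ v ∉ privs I N), w v = A'
  generalize ∑ j ∈ T, bit (y j) = K
  revert A A' K; decide

/-- **CASE P with a (NOR) chord: the literal structure of the core.**  See the module docstring. -/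
theorem caseP_nor_structure (I : LocalMap 4 n m) (hI : I.IsPure xorAndPred) (hT : Typed I) (hS : SimpleOverlap I) {r : ℕ}
    (hB : BoundaryExpanding r I) {B : BridgeData n m} {e g₀ : Fin m} {u : Fin n} {κ₀ : ZMod 2} (hD : GateDataX I r B e g₀ u κ₀)
    (hRA : ReadAlong I B e (1, 0)) (hread : AllRead I B e) {e' : Fin m} (he' : e' ∈ B.N) (hnor : NorCert I B (B.D e') (gam B e')) :
    ∃ j₁ j₂ : Fin m, ∃ σ τ : Fin n, j₁ ≠ j₂ ∧ B.D e' = {j₁, j₂} ∧ Disjoint (andPair I j₁) (andPair I j₂) ∧ σ ∈ andPair I j₁ ∧ τ ∈ andPair I j₂ ∧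
      (∃ g ∈ B.T₁ ∪ freeMon I B.N B.G₁ ∪ (B.T₂ ∪ freeMon I B.N B.G₂), σ ∈ andPair I g ∧ τ ∈ andPair I g) ∧
      (∀ v : Fin n, (∃ x, qDir I B (1, 0) (x + Pi.single v 1) ≠ qDir I B (1, 0) x) ↔ (v = σ ∨ v = τ)) ∧
      (∀ j ∈ B.D e, I.vars j 2 ∈ ({σ, τ, u} : Finset (Fin n)) ∨ I.vars j 3 ∈ ({σ, τ, u} : Finset (Fin n))) ∧
      (∀ j ∈ B.T₂, (I.vars j 2 = σ ∨ I.vars j 2 = τ) ∧ (I.vars j 3 = σ ∨ I.vars j 3 = τ)) ∧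
      (∀ j ∈ B.T₁ ∪ freeMon I B.N B.G₁, I.vars j 2 ∈ ({σ, τ, u} : Finset (Fin n)) ∨ I.vars j 3 ∈ ({σ, τ, u} : Finset (Fin n))) := by
  classical
  obtain ⟨-, hW, hr, hd₁, hd₂, hL, -, -, hG, -, -, -, -, -, -, hcoef, hT3, hM0⟩ := id hD
  have he : e ∈ B.N := hG.1
  have he'G : e' ∉ B.G₁ ∪ B.G₂ := by
    intro h
    rcases mem_union.1 h with h | h
    · exact disjoint_left.1 hd₁ h (hW.hN he')
    · exact disjoint_left.1 hd₂ h (hW.hN he')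
  obtain ⟨a, b, hab, hq, m₁, m₂, hm₁, hm₂, hQ⟩ := hnor
  set fP := polarDir I B (1, 0) with hfP
  set β : ZMod 2 := qDir I B (1, 0) b + qDir I B (1, 0) 0 with hβ
  set α : ZMod 2 := qDir I B (1, 0) a + qDir I B (1, 0) 0 with hα
  obtain ⟨j₁, j₂, σ, τ, hne12, hDe', hdisj, hσ, hτ, hlit, hreal⟩ :=
    nor_unit_of_dir I hI hS hB hW hr he' he'G (1, 0) hq hm₁ hm₂ hQ
  -- the literal functionals vanish on basis vectors outside `{σ, τ}`
  have hΓb : ∀ v ∉ ({σ, τ, u} : Finset (Fin n)), fP (Pi.single v 1) b = 0 := by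
    intro v hv
    by_contra h
    have := (hlit v).1 (Or.inl h)
    exact hv (by rw [mem_insert, mem_insert]; rcases this with h' | h' <;> simp [h'])
  have hΓa : ∀ v ∉ ({σ, τ, u} : Finset (Fin n)), fP (Pi.single v 1) a = 0 := by
    intro v hv
    by_contra h
    have := (hlit v).1 (Or.inr h)
    exact hv (by rw [mem_insert, mem_insert]; rcases this with h' | h' <;> simp [h'])
  -- CASE P in pointwise form
  have hP2 : ∀ i ∈ B.N, i ≠ e → ∀ x, ((sys I B).ρ i x).2 = 0 ∧ ((sys I B).ρ' i x).2 = 0 := by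
    intro i hi hie x
    obtain ⟨h1, h2⟩ := hRA i hi hie x
    constructor
    · rcases h1 with h | h
      · rw [h]; rfl
      · rw [h]
    · rcases h2 with h | h
      · rw [h]; rfl
      · rw [h]
  -- the base point and the flat `{x_σ, x_τ, x_u fixed}`
  obtain ⟨x₀, hq₀, hc₀⟩ := zpoint_caseP I hI hT hW hL hG hP2 hT3 (hM0 e (hW.hN he))
  have hflat : ∀ x : Fin n → ZMod 2, (∀ v ∈ ({σ, τ, u} : Finset (Fin n)), x v = x₀ v) →
      qDir I B (1, 0) x = 0 ∧ coef I B.C₁ B.G₁ (I.vars e 2) x = coef I B.C₁ B.G₁ (I.vars e 2) x₀ := by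
    intro x hx
    refine ⟨?_, by rw [hcoef, hcoef, hx u (by simp)]⟩
    rw [hq, polarDir_eq_of_agree I B (1, 0) b {σ, τ, u} hΓb hx, polarDir_eq_of_agree I B (1, 0) a {σ, τ, u} hΓa hx, ← hq]
    exact hq₀
  -- (a) the gated cycle
  have hDe : ∀ j ∈ B.D e, I.vars j 2 ∈ ({σ, τ, u} : Finset (Fin n)) ∨ I.vars j 3 ∈ ({σ, τ, u} : Finset (Fin n)) := by
    refine through_of_const_on_flat I hI hS (B.D e) {σ, τ, u} x₀ (gam B e + 1) fun x hx => ?_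
    obtain ⟨hxq, hxc⟩ := hflat x hx
    exact (caseP_forced I hI hT hW hL hG hT3 hRA hread hxq).2 (by rw [hxc]; exact hc₀)
  -- (b) the second join: the polar form of `q` is `ℓ_b ⊗ ℓ_a + ℓ_a ⊗ ℓ_b`
  have haff : ∀ (yv : Fin n → ZMod 2) (k : ZMod 2), IsAffineFn (fun x => fP x yv + k) := by
    intro yv k x w
    show fP (x + w) yv + k = fP x yv + k + (fP w yv + k) + (fP 0 yv + k)
    rw [map_add, LinearMap.add_apply, map_zero, LinearMap.zero_apply, zero_add]
    generalize fP x yv = s; generalize fP w yv = t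
    revert s t k; decide
  have hlb : IsAffineFn (fun x => fP x b + β) := haff b β
  have hla : IsAffineFn (fun x => fP x a + α) := haff a α
  have e3 : ∀ s k : ZMod 2, s + k + k = s := by decide
  have lin : ∀ {yv : Fin n → ZMod 2} {k : ZMod 2} (h : IsAffineFn (fun x => fP x yv + k)) (x : Fin n → ZMod 2), linPart h x = fP x yv := by
    intro yv k h x
    rw [linPart_apply]
    show fP x yv + k + (fP 0 yv + k) = fP x yv
    rw [map_zero, LinearMap.zero_apply, zero_add]
    exact e3 _ _
  have hqB : ∀ x w, qDir I B (1, 0) (x + w) = qDir I B (1, 0) x + qDir I B (1, 0) w + qDir I B (1, 0) 0 + fP x w := qDir_add I B (1, 0)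
  have hpol : fP = symForm (linPart hlb) (linPart hla) := by
    refine polar_unique (Q := qDir I B (1, 0)) hqB fun x w => ?_
    rw [hq, hq x, hq w, hq 0, affine_mul_polar hlb hla]
    generalize (fP x b + β) * (fP x a + α) = s; generalize (fP w b + β) * (fP w a + α) = s'
    generalize (fP 0 b + β) * (fP 0 a + α) = s₀; generalize symForm (linPart hlb) (linPart hla) x w = t
    revert s s' s₀ t; decide
  have hT₂ : ∀ j ∈ B.T₂, (I.vars j 2 = σ ∨ I.vars j 2 = τ) ∧ (I.vars j 3 = σ ∨ I.vars j 3 = τ) := by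
    intro j hj
    have hjJ : j ∈ B.J₀ := (mem_sdiff.1 (hW.hT₂ hj)).1
    have h1 : fP (Pi.single (I.vars j 2) 1) (Pi.single (I.vars j 3) 1) = 1 := by
      rw [hfP, polarDir_single_pair I hI hS hd₁ hd₂ (1, 0) hjJ, if_pos hj]; simp
    rw [hpol, symForm_apply, lin hlb, lin hla, lin hlb, lin hla] at h1
    have hc : fP (Pi.single (I.vars j 2) 1) b ≠ 0 ∨ fP (Pi.single (I.vars j 2) 1) a ≠ 0 := by
      by_contra h; push Not at h
      rw [h.1, h.2, zero_mul, mul_zero, add_zero] at h1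
      exact zero_ne_one h1
    have hd : fP (Pi.single (I.vars j 3) 1) b ≠ 0 ∨ fP (Pi.single (I.vars j 3) 1) a ≠ 0 := by
      by_contra h; push Not at h
      rw [h.1, h.2, zero_mul, mul_zero, add_zero] at h1
      exact zero_ne_one h1
    exact ⟨(hlit _).1 hc, (hlit _).1 hd⟩
  -- (c) the first join and the private-free monomials: `free₁` is constant on the flat
  have hconst := const_of_others I hW hG
  have hF₁ : ∀ x : Fin n → ZMod 2, (∀ v ∈ ({σ, τ, u} : Finset (Fin n)), x v = x₀ v) →
      ((sys I B).F x).1 = (sys I B).t.1 + 1 + coef I B.C₁ B.G₁ (I.vars e 2) x₀ +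
        ∑ i ∈ B.N.erase e, ((sys I B).ρ i 0 + (sys I B).ρ' i 0).1 := by
    intro x hx
    obtain ⟨hxq, hxc⟩ := hflat x hx
    have hfst := caseP_fst I hI hT hW hL hG hT3 hRA hxq
    have hforced := caseP_forced I hI hT hW hL hG hT3 hRA hread hxq
    -- every chord is ON at `x`
    have hON : B.N.filter (fun i => ¬ (sys I B).u i x = 0) = B.N := by
      refine filter_true_of_mem fun i hi => ?_
      rw [sys_u_eq]
      by_cases hie : i = e
      · subst hie; rw [hforced.2 (by rw [hxc]; exact hc₀)]
        generalize gam B i = t; revert t; decide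
      · rw [hforced.1 i hi hie]
        generalize gam B i = t; revert t; decide
    rw [hON, ← add_sum_erase B.N _ he, (gate_reads I hI hG x).1, (gate_reads I hI hG x).2, add_zero, hxc] at hfst
    have hsum : ∑ i ∈ B.N.erase e, ((sys I B).ρ i x + (sys I B).ρ' i x).1 = ∑ i ∈ B.N.erase e, ((sys I B).ρ i 0 + (sys I B).ρ' i 0).1 :=
      sum_congr rfl fun i hi => by
        rw [(hconst i (mem_of_mem_erase hi) (ne_of_mem_erase hi) x 0).1, (hconst i (mem_of_mem_erase hi) (ne_of_mem_erase hi) x 0).2]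
    rw [hsum] at hfst
    have e4 : ∀ F c K t : ZMod 2, F + (c + K) = t + 1 → F = t + 1 + c + K := by decide
    exact e4 _ _ _ _ hfst
  have hTG : Disjoint B.T₁ (freeMon I B.N B.G₁) := by
    unfold PstarChordBridgeForcing.freeMon
    exact disjoint_left.2 fun j hj hj' => disjoint_left.1 hd₁ (mem_filter.1 hj').1 (mem_sdiff.1 (hW.hT₁ hj)).1
  have hT₁ : ∀ j ∈ B.T₁ ∪ freeMon I B.N B.G₁, I.vars j 2 ∈ ({σ, τ, u} : Finset (Fin n)) ∨ I.vars j 3 ∈ ({σ, τ, u} : Finset (Fin n)) := by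
    refine through_of_const_on_flat_affine I hI hS _ {σ, τ, u} x₀
      ((sys I B).t.1 + 1 + coef I B.C₁ B.G₁ (I.vars e 2) x₀ + ∑ i ∈ B.N.erase e, ((sys I B).ρ i 0 + (sys I B).ρ' i 0).1)
      (isAffineFn_freeLin I B.y (B.J₀ \ B.N) B.N B.T₁ B.C₁) fun x hx => ?_
    rw [← free_eq_qform I B.y (B.J₀ \ B.N) B.N B.T₁ B.C₁ B.G₁ hTG x, ← hF₁ x hx, sys_F]
  -- the literal pair, cert-independently (`lit_iff_of_dir`)
  have hlit' : ∀ v : Fin n, (∃ x, qDir I B (1, 0) (x + Pi.single v 1) ≠ qDir I B (1, 0) x) ↔ (v = σ ∨ v = τ) :=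
    fun v => (PstarNorUnitDir.lit_iff_of_dir I B (1, 0) hab hq v).symm.trans (hlit v)
  exact ⟨j₁, j₂, σ, τ, hne12, hDe', hdisj, hσ, hτ, hreal, hlit', hDe, hT₂, hT₁⟩

end Summit.PneNP.PneNP.Theorems.PstarGateCasePNorJoins
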